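import Summits.AtomisticToContinuum.Crystallization.Theorems.PricedLinkCensusTruncatedCensusGapUnderCoordinationPeriodicBlocks

/-!
# The under-coordination census gap (class (U)) is EXACTLY a periodic under-coordination pricing

Helper (U-PERIODIC FORM, part 2 of 2) for the stub `stub_underCoordinationGap` (class (U) of the
census split `Cruxes/TruncatedCensusGap/Lines/birth.lean`) of the crux
`PricedLinkCensus.TruncatedCensusGap` (item stmt-AtomisticToContinuum-14230).  Notation as in
part 1 (`…UnderCoordinationPeriodicBlocks.lean`): `V_χ`, `e_χ*`, bond counts `b_i` at tolerance
`1/100`, under-coordinated sites `U(y) = {i | b_i < 12}`; the stub (U) reads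
`∃ κ > 0, ∀ N (y : Fin N → ℝ³) injective, N · e_χ* + κ · #U(y) ≤ E_χ(y)`.

**Theorem (`underCoordinationGap_iff_periodicUnderPricing`).**  (U) is EQUIVALENT to the
PERIODIC UNDER-COORDINATION PRICING

  `∃ κ > 0, ∀ Q : PeriodicConfiguration 3, κ · #{motif sites of Q with < 12 bonds in Q.points}`
  `   ≤ #F · (e_χ(Q) − e_χ*)`,

the `U`-twin of the landed `truncatedCensusGap_iff_periodicPricing` (…CruxForms.lean, charge
replaced by under-coordination).  So, exactly as for the crux, finite clusters, free surfaces and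
`N` play no role in (U): it is the statement "in Blanc–Lewin's periodic universe, the excess
`V_χ`-energy density of a periodic configuration over the periodic infimum controls, linearly and
uniformly, its density of sites with fewer than twelve `1 %`-bonds" — finite-range periodic
crystallization for `V_χ` with pricing of missing bonds AND of the elastic `1 %`-threshold events
(`Cruxes/TruncatedCensusGap/Disproof.lean` §6: one bond compressed by just over `1 %` leaves
twenty sites with fewer than twelve bonds for an elastic price `≈ 5e-4`, so any valid
`κ ≤ 2.7e-5` if `e_χ* = e_χ(hcp*)`).  This is the precise open content of (U).

* `⇒` is part 1 (`periodicUnderPricing_of_underCoordinationGap`, blocks);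
* `⇐` (`underCoordinationGap_of_periodicUnderPricing`): far periodisation `y + (8D+8)ℤ³`
  (`ChargedEnergyGapNegative.periodiseFar`); its motif sites with `< 12` bonds are exactly the
  under-coordinated sites of `y` (`motifUnder_periodiseFar`), and its energy per particle is
  EXACTLY `E_χ(y)/N` (`energyPerParticle_periodiseFar_eq_div`, range `2 ≤ 8`); `N ≤ 1` from the
  dimer instance `e_χ* + κ ≤ -1/24`;
* consequences: `periodicUnderPricing_of_periodicPricing` (`U ⊆ charged`, so the crux's periodic
  pricing gives the `U`-pricing with the same `κ`) and the KILL CRITERION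
  `lt_energyPerParticle_of_motifUnder` (under (U), a periodic configuration with one
  under-coordinated motif site is not a periodic `V_χ`-minimiser).

All `[folklore]` bookkeeping; the content of (U) is untouched.
-/

noncomputable section

namespace Summit.AtomisticToContinuum.Crystallization.Theorems.PricedLinkCensusTruncatedCensusGap

open Literature.MathematicalPhysics.StatisticalMechanics Literature.Geometry.DiscreteGeometry
open Summit.AtomisticToContinuum.Crystallization.Theorems.ChargedEnergyGapNegative
open Summit.AtomisticToContinuum.Crystallization.Theorems.ChargedEnergyGapNegative.Blocks

/-! ## The periodic under-coordination pricing ⇒ (U) (far periodisation) -/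

/-- **The periodic under-coordination pricing implies the under-coordination gap** (same `κ`):
far periodisation for `N ≥ 2` (its under-coordinated motif sites are those of `y`, its energy
per particle is exactly `E_χ(y)/N`); the dimer instance `e_χ* + κ ≤ -1/24` settles `N ≤ 1`.
[folklore] -/
theorem underCoordinationGap_of_periodicUnderPricing :
    (∃ κ : ℝ, 0 < κ ∧ ∀ Q : PeriodicConfiguration 3,
      κ * (Nat.card {x : Q.motif // ((bondGraph (1 / 100 : ℝ)
          (Subtype.val : Q.points → EuclideanSpace ℝ (Fin 3))).neighborSet
            ⟨x.1, Q.mem_points_of_mem_motif x.2⟩).ncard < 12} : ℝ) ≤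
        (Q.motif.card : ℝ) * (Q.energyPerParticle (fun r => min 1 (max 0 (4 - 2 * r)) * lennardJones r) -
          ⨅ Q' : PeriodicConfiguration 3,
            Q'.energyPerParticle (fun r => min 1 (max 0 (4 - 2 * r)) * lennardJones r))) →
    (∃ κ : ℝ, 0 < κ ∧ ∀ (N : ℕ) (y : Fin N → EuclideanSpace ℝ (Fin 3)), Function.Injective y →
      (N : ℝ) * (⨅ Q : PeriodicConfiguration 3,
          Q.energyPerParticle (fun r => min 1 (max 0 (4 - 2 * r)) * lennardJones r)) +
        κ * (Nat.card {i : Fin N //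
          ((bondGraph (1 / 100 : ℝ) y).neighborSet i).ncard < 12} : ℝ) ≤
      interactionEnergy (fun r => min 1 (max 0 (4 - 2 * r)) * lennardJones r) y) := by
  rintro ⟨κ, hκ, h⟩
  -- `N ≥ 2`: the far periodisation
  have main : ∀ {N : ℕ}, 2 ≤ N → ∀ (y : Fin N → E3), Function.Injective y →
      (N : ℝ) * (⨅ Q : PeriodicConfiguration 3,
          Q.energyPerParticle (fun r => min 1 (max 0 (4 - 2 * r)) * lennardJones r)) +
        κ * (Nat.card {i : Fin N //
          ((bondGraph (1 / 100 : ℝ) y).neighborSet i).ncard < 12} : ℝ) ≤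
        interactionEnergy (fun r => min 1 (max 0 (4 - 2 * r)) * lennardJones r) y := by
    intro N hN y hy
    have hN0 : 0 < N := by omega
    have hN2 : ∀ i : Fin N, ∃ j, j ≠ i := exists_ne_of_two_le hN
    have hp := h (periodiseFar y hN0)
    rw [motifUnder_periodiseFar hy hN0 hN2] at hp
    have hcard : (((periodiseFar y hN0).motif.card : ℕ) : ℝ) = N := by
      rw [motif_periodiseFar, Finset.card_image_of_injective _ hy, Finset.card_univ,
        Fintype.card_fin]
    have he : (periodiseFar y hN0).energyPerParticle
        (fun r => min 1 (max 0 (4 - 2 * r)) * lennardJones r) =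
        interactionEnergy (fun r => min 1 (max 0 (4 - 2 * r)) * lennardJones r) y / N :=
      energyPerParticle_periodiseFar_eq_div truncLJ_eq_zero_of_two_le (by norm_num) hy hN0
    rw [hcard, he, mul_sub] at hp
    have hNr : (0 : ℝ) < N := by exact_mod_cast hN0
    have hmul : (N : ℝ) *
        (interactionEnergy (fun r => min 1 (max 0 (4 - 2 * r)) * lennardJones r) y / N) =
        interactionEnergy (fun r => min 1 (max 0 (4 - 2 * r)) * lennardJones r) y := by
      field_simp
    linarith
  -- the dimer instance: `e_χ* + κ ≤ -1/24`
  have hdimer : (⨅ Q : PeriodicConfiguration 3,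
      Q.energyPerParticle (fun r => min 1 (max 0 (4 - 2 * r)) * lennardJones r)) + κ ≤
        -1 / 24 := by
    have h2 := main le_rfl _ injective_pair_zero_single
    rw [under_eq_of_le (by norm_num)
      ![(0 : EuclideanSpace ℝ (Fin 3)), EuclideanSpace.single 0 1],
      interactionEnergy_truncLJ_pair] at h2
    push_cast at h2
    linarith
  refine ⟨κ, hκ, fun N y hy => ?_⟩
  rcases Nat.lt_or_ge N 2 with hN | hN
  · interval_cases N
    · rw [under_eq_of_le (by norm_num) y, interactionEnergy_of_subsingleton]
      simp
    · rw [under_eq_of_le (by norm_num) y, interactionEnergy_of_subsingleton]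
      push_cast
      linarith
  · exact main hN y hy

/-! ## The equivalence, and two consequences -/

/-- **The under-coordination census gap (U) is EQUIVALENT to the periodic under-coordination
pricing for `V_χ`** (the `U`-twin of `truncatedCensusGap_iff_periodicPricing`): the precise
open content of stub (U) of the census split. [folklore] -/
theorem underCoordinationGap_iff_periodicUnderPricing :
    (∃ κ : ℝ, 0 < κ ∧ ∀ (N : ℕ) (y : Fin N → EuclideanSpace ℝ (Fin 3)), Function.Injective y →
      (N : ℝ) * (⨅ Q : Literature.MathematicalPhysics.StatisticalMechanics.PeriodicConfiguration 3,
          Q.energyPerParticle (fun r => min 1 (max 0 (4 - 2 * r)) *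
            Literature.MathematicalPhysics.StatisticalMechanics.lennardJones r)) +
        κ * (Nat.card {i : Fin N //
          ((Literature.Geometry.DiscreteGeometry.bondGraph (1 / 100 : ℝ) y).neighborSet i).ncard <
            12} : ℝ) ≤
      Literature.MathematicalPhysics.StatisticalMechanics.interactionEnergy
        (fun r => min 1 (max 0 (4 - 2 * r)) *
          Literature.MathematicalPhysics.StatisticalMechanics.lennardJones r) y) ↔
    (∃ κ : ℝ, 0 < κ ∧
      ∀ Q : Literature.MathematicalPhysics.StatisticalMechanics.PeriodicConfiguration 3,
        κ * (Nat.card {x : Q.motif //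
          ((Literature.Geometry.DiscreteGeometry.bondGraph (1 / 100 : ℝ)
            (Subtype.val : Q.points → EuclideanSpace ℝ (Fin 3))).neighborSet
              ⟨x.1, Q.mem_points_of_mem_motif x.2⟩).ncard < 12} : ℝ) ≤
        (Q.motif.card : ℝ) *
          (Q.energyPerParticle (fun r => min 1 (max 0 (4 - 2 * r)) *
              Literature.MathematicalPhysics.StatisticalMechanics.lennardJones r) -
            ⨅ Q' : Literature.MathematicalPhysics.StatisticalMechanics.PeriodicConfiguration 3,
              Q'.energyPerParticle (fun r => min 1 (max 0 (4 - 2 * r)) *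
                Literature.MathematicalPhysics.StatisticalMechanics.lennardJones r))) :=
  ⟨periodicUnderPricing_of_underCoordinationGap, underCoordinationGap_of_periodicUnderPricing⟩

/-- `U ⊆ charged`: an under-coordinated site is not charge-free, so the periodic (charge)
pricing of `truncatedCensusGap_iff_periodicPricing` implies the periodic under-coordination
pricing with the same `κ`. [folklore] -/
theorem periodicUnderPricing_of_periodicPricing {κ : ℝ}
    (h : ∀ Q : PeriodicConfiguration 3,
      κ * (Summit.AtomisticToContinuum.Crystallization.Theorems.ChargedEnergyGapNegative.motifCharged
        (1 / 100) Q : ℝ) ≤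
        (Q.motif.card : ℝ) * (Q.energyPerParticle (fun r => min 1 (max 0 (4 - 2 * r)) * lennardJones r) -
          ⨅ Q' : PeriodicConfiguration 3,
            Q'.energyPerParticle (fun r => min 1 (max 0 (4 - 2 * r)) * lennardJones r)))
    (hκ : 0 ≤ κ) (Q : PeriodicConfiguration 3) :
    κ * (Nat.card {x : Q.motif // ((bondGraph (1 / 100 : ℝ)
        (Subtype.val : Q.points → EuclideanSpace ℝ (Fin 3))).neighborSet
          ⟨x.1, Q.mem_points_of_mem_motif x.2⟩).ncard < 12} : ℝ) ≤
      (Q.motif.card : ℝ) * (Q.energyPerParticle (fun r => min 1 (max 0 (4 - 2 * r)) * lennardJones r) -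
        ⨅ Q' : PeriodicConfiguration 3,
          Q'.energyPerParticle (fun r => min 1 (max 0 (4 - 2 * r)) * lennardJones r)) := by
  have hle : Nat.card {x : Q.motif // ((bondGraph (1 / 100 : ℝ)
        (Subtype.val : Q.points → EuclideanSpace ℝ (Fin 3))).neighborSet
          ⟨x.1, Q.mem_points_of_mem_motif x.2⟩).ncard < 12} ≤ motifCharged (1 / 100) Q := by
    unfold motifCharged
    exact Nat.card_le_card_of_injective _
      (Subtype.impEmbedding
        (fun x : Q.motif => ((bondGraph (1 / 100 : ℝ)
          (Subtype.val : Q.points → EuclideanSpace ℝ (Fin 3))).neighborSet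
            ⟨x.1, Q.mem_points_of_mem_motif x.2⟩).ncard < 12)
        (fun x : Q.motif => ¬ IsChargeFree (1 / 100 : ℝ)
          (Subtype.val : Q.points → EuclideanSpace ℝ (Fin 3))
            ⟨x.1, Q.mem_points_of_mem_motif x.2⟩)
        fun x hx hc => absurd hc.ncard_neighborSet hx.ne).injective
  have := mul_le_mul_of_nonneg_left (show ((Nat.card {x : Q.motif // ((bondGraph (1 / 100 : ℝ)
        (Subtype.val : Q.points → EuclideanSpace ℝ (Fin 3))).neighborSet
          ⟨x.1, Q.mem_points_of_mem_motif x.2⟩).ncard < 12} : ℕ) : ℝ) ≤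
      (motifCharged (1 / 100) Q : ℝ) by exact_mod_cast hle) hκ
  exact this.trans (h Q)

/-- **Kill criterion for (U).**  Under the under-coordination gap, a periodic configuration with
at least one under-coordinated motif site (fewer than twelve `1 %`-bonds, read in the infinite
point set) lies STRICTLY above the periodic infimum: `e_χ* < e_χ(Q)`.  Contrapositive: a
periodic `V_χ`-minimiser with an under-coordinated site refutes (U) (and the crux). [folklore] -/
theorem lt_energyPerParticle_of_motifUnder
    (hU : ∃ κ : ℝ, 0 < κ ∧ ∀ (N : ℕ) (y : Fin N → EuclideanSpace ℝ (Fin 3)), Function.Injective y →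
      (N : ℝ) * (⨅ Q : PeriodicConfiguration 3,
          Q.energyPerParticle (fun r => min 1 (max 0 (4 - 2 * r)) * lennardJones r)) +
        κ * (Nat.card {i : Fin N //
          ((bondGraph (1 / 100 : ℝ) y).neighborSet i).ncard < 12} : ℝ) ≤
      interactionEnergy (fun r => min 1 (max 0 (4 - 2 * r)) * lennardJones r) y)
    (Q : PeriodicConfiguration 3)
    (hQ : 0 < Nat.card {x : Q.motif // ((bondGraph (1 / 100 : ℝ)
        (Subtype.val : Q.points → EuclideanSpace ℝ (Fin 3))).neighborSet
          ⟨x.1, Q.mem_points_of_mem_motif x.2⟩).ncard < 12}) :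
    (⨅ Q' : PeriodicConfiguration 3,
        Q'.energyPerParticle (fun r => min 1 (max 0 (4 - 2 * r)) * lennardJones r)) <
      Q.energyPerParticle (fun r => min 1 (max 0 (4 - 2 * r)) * lennardJones r) := by
  obtain ⟨κ, hκ, hp⟩ := periodicUnderPricing_of_underCoordinationGap hU
  have h1 := hp Q
  have hF : (0 : ℝ) < Q.motif.card := by exact_mod_cast Q.motif_nonempty.card_pos
  have hm : (1 : ℝ) ≤ Nat.card {x : Q.motif // ((bondGraph (1 / 100 : ℝ)
      (Subtype.val : Q.points → EuclideanSpace ℝ (Fin 3))).neighborSet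
        ⟨x.1, Q.mem_points_of_mem_motif x.2⟩).ncard < 12} := by exact_mod_cast hQ
  have hpos : 0 < κ * (Nat.card {x : Q.motif // ((bondGraph (1 / 100 : ℝ)
      (Subtype.val : Q.points → EuclideanSpace ℝ (Fin 3))).neighborSet
        ⟨x.1, Q.mem_points_of_mem_motif x.2⟩).ncard < 12} : ℝ) := mul_pos hκ (by linarith)
  by_contra hle
  push Not at hle
  have : (Q.motif.card : ℝ) * (Q.energyPerParticle (fun r => min 1 (max 0 (4 - 2 * r)) * lennardJones r) -
      ⨅ Q' : PeriodicConfiguration 3,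
        Q'.energyPerParticle (fun r => min 1 (max 0 (4 - 2 * r)) * lennardJones r)) ≤ 0 :=
    mul_nonpos_of_nonneg_of_nonpos hF.le (by linarith)
  linarith

end Summit.AtomisticToContinuum.Crystallization.Theorems.PricedLinkCensusTruncatedCensusGap

end
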